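import Summits.PneNP.PneNP.Theorems.ChebyshevTracialDesignRungCells
import Summits.PneNP.PneNP.Theorems.ChebyshevTracialDesignClosedPairCount
import Summits.PneNP.PneNP.Theorems.ChebyshevTracialDesignDipoleHitRatio
import HarnessLib

/-!
# Cell pnp-psdrank, route `ChebyshevTracialDesign`: the PIECES of the `r = 1` rung — one Kupavskii–Zakharov piece at a time

Harmonic backbone of the crux `TracialDecayExp20` (stmt-PneNP-19878), brick 31 (prover g8; step S6, MEMO-10 §3). For a tight-free rectangle
`A × Y` (`A` a family of `t`-cuts), an exact design of degree `D` with variation `≤ B_v`, and the `i`-th piece `Y_i = {M ∈ Y : M ∈ ℱ_i}` of a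
Kupavskii–Zakharov spread approximation of the edge sets of `Y` (core `S_i`, `|S_i| ≤ q`, ambient family = all perfect matchings):
* §1 stars of partial matchings: `|{M : S ⊆ M}| = pm(n − 2|S|)`, `pm(m) ≤ pm(m+2j) ≤ (m+2j)^j pm(m)`, hence `|PM_n| ≤ n^q·|{M : S ⊆ M}|`
  and the NUMBER OF PIECES `k ≤ τ^{q+1} n^q` (`card_pieces_le`, from the modified stopping rule `|⟨S_i⟩| ≤ τ^{q+1}|ℱ_i|`);
* §2 the reduced instance of a non-crossing cell: cut sizes, tight-freeness transfers (`cc = cc'' + 0`), and the **SNT dichotomy**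
  `reduced_mu_le_of_snt` — if the reduced pair is tight-free and SNT applies, one reduced density is below threshold, so every `μ''_c ≤ β`;
* §3 **`abs_piece_value_le`**: `|Σ_{A × Y_i} W| ≤ 4^q·B_v·√P_{D−4} + β·B_v·ν(⟨S_i⟩)` — crossing patterns by brick 30's `abs_crossing_cell_le`
  (`≤ 4^{|S_i|}` of them), non-crossing patterns by `abs_noncrossing_cell_le` with `β ≥ exp(−c₀·dq(n − 2|S_i|))` supplied by SNT in `K_{n−2|S_i|}`
  (brick 29 `snt_sym_oddSet_of_globalLevelD`, taken as a hypothesis), summed with `sum_patterns_cellRatio_le`.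
[cite: Rothvoss2017, §2 (PDF p. 6)] [cite: KupavskiiZakharov2022, §2 and Lemma 11] [cite: KeevashLifshitz2023, Thm. 1.8]
Stature: support/instrument. WHAT THIS IS NOT: not the r = 1 rung (the sum over pieces and the constants are the next file), nothing on psd rank,
no P-vs-NP content. Supports stmt-PneNP-19878.
-/

set_option linter.dupNamespace false -- `Summit.PneNP.PneNP.…`: summit = sub-problem (D-0017)

noncomputable section

namespace Summit.PneNP.PneNP.Theorems.ChebyshevTracialDesignRungPieces

open Finset Literature.Combinatorics.Optimization
open Literature.Barriers.PneNP hiding verts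
open Literature.Combinatorics.SetFamily
open Literature.Combinatorics.SimpleGraph.CycleSpace
open Literature.Combinatorics.AssociationSchemes.CutMatchingRestriction
open Literature.Combinatorics.AssociationSchemes.HomogeneousMatchingFamilies
open Summit.PneNP.PneNP.Theorems.ChebyshevTracialDesignProfilePolynomial (card_pmatch_pos)
open Summit.PneNP.PneNP.Theorems.ChebyshevTracialDesignLevelMarginals
open Summit.PneNP.PneNP.Theorems.ChebyshevTracialDesignRungCells
open Summit.PneNP.PneNP.Theorems.ChebyshevTracialDesignClosedPairCount (card_perfectMatchings_eq_pmCount succ_mul_pmCount)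
open Summit.PneNP.PneNP.Theorems.ChebyshevTracialDesignDipoleHitRatio (card_pmatch_eq_pmCount)

variable {n : ℕ}

/-! ### §1 Stars of partial matchings and the number of pieces -/

/-- `pm(m) ≤ pm(m + 2j)`. [folklore] -/
theorem pmCount_le_pmCount_add (m : ℕ) : ∀ j : ℕ, pmCount m ≤ pmCount (m + 2 * j)
  | 0 => by simp
  | j + 1 => by
    calc pmCount m ≤ pmCount (m + 2 * j) := pmCount_le_pmCount_add m j
      _ ≤ (m + 2 * j + 1) * pmCount (m + 2 * j) := Nat.le_mul_of_pos_left _ (by omega)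
      _ = pmCount (m + 2 * (j + 1)) := by rw [succ_mul_pmCount]; ring_nf

/-- `pm(m + 2j) ≤ (m + 2j)^j · pm(m)`. [folklore] -/
theorem pmCount_add_le_pow_mul (m : ℕ) : ∀ j : ℕ, pmCount (m + 2 * j) ≤ (m + 2 * j) ^ j * pmCount m
  | 0 => by simp
  | j + 1 => by
    have e : m + 2 * (j + 1) = m + 2 * j + 2 := by ring
    calc pmCount (m + 2 * (j + 1)) = (m + 2 * j + 1) * pmCount (m + 2 * j) := by rw [e, ← succ_mul_pmCount]
      _ ≤ (m + 2 * j + 1) * ((m + 2 * j) ^ j * pmCount m) := Nat.mul_le_mul_left _ (pmCount_add_le_pow_mul m j)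
      _ ≤ (m + 2 * (j + 1)) * ((m + 2 * (j + 1)) ^ j * pmCount m) :=
          Nat.mul_le_mul (by omega) (Nat.mul_le_mul_right _ (Nat.pow_le_pow_left (by omega) j))
      _ = (m + 2 * (j + 1)) ^ (j + 1) * pmCount m := by ring

/-- The star of a set of edges in `PMatch` currency has the cardinality of Kupavskii–Zakharov's `𝒜(S)`.
[cite: KupavskiiZakharov2022, §2] -/
theorem card_star_pmatch_eq (S : Finset (Sym2 (Fin n))) :
    (univ.filter fun M : PMatch n => S ⊆ M.1).card = (supersets (perfectMatchings (univ : Finset (Fin n))) S).card := by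
  refine card_bij (fun M _ => M.1) (fun M hM => ?_) (fun M _ M' _ h => Subtype.ext h) (fun M hM => ?_)
  · rw [mem_supersets, mem_perfectMatchings]
    exact ⟨M.2, (mem_filter.1 hM).2⟩
  · rw [mem_supersets, mem_perfectMatchings] at hM
    exact ⟨⟨M, hM.1⟩, by simp [hM.2], rfl⟩

/-- **The star of a partial matching**: for a perfect matching `S` of `V ⊆ Fin n`, `|{M ∈ PM_n : S ⊆ M}| = pm(n − |V|)`.
[cite: KupavskiiZakharov2022, §2 (p. 6: the link 𝒜(S))] -/
theorem card_supersets_perfectMatchings_eq {V : Finset (Fin n)} {S : Finset (Sym2 (Fin n))} (hS : IsPMOn V S) :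
    (supersets (perfectMatchings (univ : Finset (Fin n))) S).card = pmCount (n - V.card) := by
  rw [← card_link, link_perfectMatchings_eq hS (subset_univ V), card_perfectMatchings_eq_pmCount, card_univ_sdiff,
    Fintype.card_fin]

/-- **Stars are not too small**: `|PM_n| ≤ n^q · |{M : S ⊆ M}|` for a partial matching `S` with `|S| ≤ q`. [cite: KupavskiiZakharov2022, §2] -/
theorem card_pmatch_le_pow_mul_card_star {V : Finset (Fin n)} {S : Finset (Sym2 (Fin n))} (hS : IsPMOn V S) {q : ℕ}
    (hSq : S.card ≤ q) (hn : 1 ≤ n) :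
    (Fintype.card (PMatch n) : ℝ) ≤ (n : ℝ) ^ q * (supersets (perfectMatchings (univ : Finset (Fin n))) S).card := by
  rw [card_supersets_perfectMatchings_eq hS, card_pmatch_eq_pmCount]
  have hV : V.card = 2 * S.card := hS.two_mul_card.symm
  have hVn : V.card ≤ n := by simpa using card_le_univ V
  have key := pmCount_add_le_pow_mul (n - V.card) S.card
  have e : n - V.card + 2 * S.card = n := by omega
  rw [e] at key
  have h1 : (pmCount n : ℝ) ≤ (n : ℝ) ^ S.card * pmCount (n - V.card) := by exact_mod_cast key
  have h2 : (n : ℝ) ^ S.card ≤ (n : ℝ) ^ q := pow_le_pow_right₀ (by exact_mod_cast hn) hSq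
  calc (pmCount n : ℝ) ≤ (n : ℝ) ^ S.card * pmCount (n - V.card) := h1
    _ ≤ (n : ℝ) ^ q * pmCount (n - V.card) := mul_le_mul_of_nonneg_right h2 (Nat.cast_nonneg _)

/-- **The number of Kupavskii–Zakharov pieces** of a family of perfect matchings of `K_n` (`n` even, `n ≥ 1`, cores of size `≤ q`,
parameter `τ > 0`): `k ≤ τ^{q+1} · n^q` — each piece pays for its star (`|⟨S_i⟩| ≤ τ^{q+1}|ℱ_i|`, the modified stopping rule), stars have
density `≥ n^{−q}`, and the pieces are disjoint. [cite: KupavskiiZakharov2022, Lemma 11 (procedure)] -/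
theorem card_pieces_le (hn : Even n) (hn1 : 1 ≤ n) (Y : Finset (PMatch n)) {τ : ℝ} (hτ : 0 < τ) {q : ℕ}
    (Dk : SpreadApproximation (perfectMatchings (univ : Finset (Fin n))) (Y.image Subtype.val) τ q) :
    (Dk.k : ℝ) ≤ τ ^ (q + 1) * (n : ℝ) ^ q := by
  have hPM : (0 : ℝ) < Fintype.card (PMatch n) := by exact_mod_cast card_pmatch_pos hn
  -- every piece has at least `|PM_n| / (τ^{q+1} n^q)` members
  have hpiece : ∀ i : Fin Dk.k, (Fintype.card (PMatch n) : ℝ) ≤ τ ^ (q + 1) * (n : ℝ) ^ q * (Dk.piece i).card := by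
    intro i
    have hS := isPMOn_verts_core (image_val_subset Y) Dk i
    have h1 := card_pmatch_le_pow_mul_card_star hS (Dk.card_core_le i) hn1
    have h2 := Dk.card_supersets_le i
    calc (Fintype.card (PMatch n) : ℝ) ≤ (n : ℝ) ^ q * (supersets (perfectMatchings univ) (Dk.core i)).card := h1
      _ ≤ (n : ℝ) ^ q * (τ ^ (q + 1) * (Dk.piece i).card) := mul_le_mul_of_nonneg_left h2 (by positivity)
      _ = τ ^ (q + 1) * (n : ℝ) ^ q * (Dk.piece i).card := by ring
  have hsum : ∑ i : Fin Dk.k, ((Dk.piece i).card : ℝ) ≤ Fintype.card (PMatch n) := by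
    have h1 : ((∑ i, (Dk.piece i).card : ℕ) : ℝ) ≤ (Y.image Subtype.val).card := by exact_mod_cast Dk.sum_card_piece_le
    rw [Nat.cast_sum] at h1
    refine h1.trans ?_
    rw [card_image_of_injective _ Subtype.val_injective]
    exact_mod_cast (card_le_univ Y).trans_eq Finset.card_univ
  have hk : (Dk.k : ℝ) * Fintype.card (PMatch n) ≤ τ ^ (q + 1) * (n : ℝ) ^ q * ∑ i : Fin Dk.k, ((Dk.piece i).card : ℝ) := by
    rw [mul_sum]
    have := sum_le_sum fun i (_ : i ∈ (univ : Finset (Fin Dk.k))) => hpiece i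
    rw [sum_const, card_univ, Fintype.card_fin, nsmul_eq_mul] at this
    exact this
  have := hk.trans (mul_le_mul_of_nonneg_left hsum (by positivity))
  exact le_of_mul_le_mul_right this hPM

/-! ### §2 The reduced instance of a non-crossing cell -/

/-- Reduced cuts of `t`-cuts with pattern `π` have size `t − |π|`. [cite: Rothvoss2017, §2 (PDF p. 6)] -/
theorem card_of_mem_oddCellCuts {m t : ℕ} {A : Finset (OddSet n)} (hA : ∀ U ∈ A, U.1.card = t) {V π : Finset (Fin n)}
    {h : (univ \ V).card = m} {Ut : OddSet m} (hUt : Ut ∈ oddCellCuts A V π h) : Ut.1.card = t - π.card := by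
  have hmem : Ut.1 ∈ cellCuts (A.image Subtype.val) V π h := (mem_subtype.1 hUt)
  have := card_add_of_mem_cellCuts hmem (t := t) (fun U hU => by
    obtain ⟨U', hU', rfl⟩ := mem_image.1 hU; exact hA U' hU')
  omega

/-- **Tight-freeness passes to the reduced instance of a non-crossing cell** (`cc = cc'' + crossCount π S = cc''`).
[cite: Rothvoss2017, §2 (PDF pp. 5–6)] -/
theorem tightFree_reduced {m : ℕ} {A : Finset (OddSet n)} {B : Finset (PMatch n)} (hAB : ∀ U ∈ A, ∀ M ∈ B, cc U M ≠ 1)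
    {V π : Finset (Fin n)} {S : Finset (Sym2 (Fin n))} (hS : IsPMOn V S) (hπ0 : crossCount π S = 0)
    (h : (univ \ V).card = m) :
    ∀ Ut ∈ oddCellCuts A V π h, ∀ Mt ∈ pmCellMatchings B V S h, cc Ut Mt ≠ 1 := by
  intro Ut hUt Mt hMt
  obtain ⟨U, hU, hUV, hUt'⟩ := mem_cellCuts.1 (mem_subtype.1 hUt)
  obtain ⟨U', hU'A, rfl⟩ := mem_image.1 hU
  obtain ⟨M, hM, hSM, hMt'⟩ := mem_cellMatchings.1 (mem_subtype.1 hMt)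
  obtain ⟨M', hM'B, rfl⟩ := mem_image.1 hM
  have hsplit := crossCount_eq_crossCount_pullback_add h hS M'.2 hSM U'.1
  rw [hUt', hMt', hUV, hπ0, add_zero] at hsplit
  rw [cc_eq_crossCount, ← hsplit, ← cc_eq_crossCount]
  exact hAB U' hU'A M' hM'B

/-- **The SNT dichotomy in the reduced instance.** If `X̃` (all of cut size `t''`, `t''` odd) and `Ỹ` form a tight-free pair in `K_m` and
spectral non-tightness applies to them at threshold `exp(−c₀·dq m) ≤ β` (hypothesis `hsnt`: both densities `≥ exp(−c₀·dq m)` would give a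
tight pair), then every Rothvoß measure `μ''_c(X̃ × Ỹ) ≤ β` (one density is small, and `μ''_c` is below both densities).
[cite: Rothvoss2017, §2 (PDF p. 6)] [cite: KeevashLifshitz2023, Thm. 1.8] -/
theorem reduced_mu_le_of_snt {m t'' : ℕ} (ht'' : Odd t'') (X : Finset (OddSet m)) (hX : ∀ U ∈ X, U.1.card = t'')
    (Y : Finset (PMatch m)) (htf : ∀ U ∈ X, ∀ M ∈ Y, cc U M ≠ 1) {c₀ β : ℝ} (hβ : Real.exp (-(c₀ * dq m)) ≤ β)
    (hsnt : Real.exp (-(c₀ * dq m)) ≤ (X.card : ℝ) / (m.choose t'' : ℝ) →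
      Real.exp (-(c₀ * dq m)) ≤ (Y.card : ℝ) / (Fintype.card (PMatch m) : ℝ) → ∃ U ∈ X, ∃ M ∈ Y, cc U M = 1) (c : ℕ) :
    mu m t'' c X Y ≤ β := by
  have hrow := mu_le_row (n := m) t'' c X Y
  rw [filter_true_of_mem hX, card_tcuts_eq_choose ht''] at hrow
  have hcol := mu_le_col (n := m) t'' c X Y
  by_cases h1 : Real.exp (-(c₀ * dq m)) ≤ (X.card : ℝ) / (m.choose t'' : ℝ)
  · by_cases h2 : Real.exp (-(c₀ * dq m)) ≤ (Y.card : ℝ) / (Fintype.card (PMatch m) : ℝ)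
    · obtain ⟨U, hU, M, hM, hUM⟩ := hsnt h1 h2
      exact absurd hUM (htf U hU M hM)
    · push Not at h2; linarith
  · push Not at h1; linarith

/-! ### §3 One piece of the spread approximation -/

set_option maxHeartbeats 400000 in
/-- **The value of a tight-free rectangle on one Kupavskii–Zakharov piece.** Let `n` be even, `(n, t = 2c'+1, T, D, B_v, C, w)` an exact design
with `4 ≤ D ≤ 2c'` and `n ≤ 4t`, `A` a family of `t`-cuts and `Y` a set of perfect matchings with `A × Y` tight-free, `Dk` a spread approximation
of the edge sets of `Y` among all perfect matchings (parameter `τ`, cores of size `≤ q` with `40q ≤ n`), and `i` one of its pieces. Assume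
spectral non-tightness in every reduced instance `K_m`, `n − 2q ≤ m ≤ n` (hypothesis `hSNT`, threshold `exp(−c₀·dq m) ≤ β`, range `m ≥ n₁` with
`n₁ + 2q ≤ n`). Then `|Σ_{U∈A} Σ_{M ∈ Y_i} W(U,M)| ≤ 4^q·B_v·√P_{D−4} + β·B_v·|⟨S_i⟩|/|PM_n|`.
[cite: Rothvoss2017, §2 (PDF p. 6)] [cite: KupavskiiZakharov2022, Lemma 11] [cite: KeevashLifshitz2023, Thm. 1.8] -/
theorem abs_piece_value_le {c' T Dg q n₁ : ℕ} {Bv τ c₀ β : ℝ} {C : Finset ℕ} {w : ℕ → ℝ} (hn : Even n)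
    (hdes : IsExactDesign n (2 * c' + 1) T Dg Bv C w) (hDg : Dg ≤ 2 * c') (hDg4 : 4 ≤ Dg)
    (hbal : n ≤ 4 * (2 * c' + 1)) (hq : 40 * q ≤ n) (hn₁ : n₁ + 2 * q ≤ n)
    (hSNT : ∀ (m t : ℕ), n₁ ≤ m → Even m → Odd t → m ≤ 5 * t → m ≤ 5 * (m - t) →
      ∀ (X : Finset (OddSet m)), (∀ U ∈ X, U.1.card = t) →
      ∀ (Y' : Finset (PMatch m)), IsRelHomogeneous τ (perfectMatchings (univ : Finset (Fin m))) (Y'.image Subtype.val) →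
      Real.exp (-(c₀ * dq m)) ≤ (X.card : ℝ) / (m.choose t : ℝ) →
      Real.exp (-(c₀ * dq m)) ≤ (Y'.card : ℝ) / (Fintype.card (PMatch m) : ℝ) → ∃ U ∈ X, ∃ M ∈ Y', cc U M = 1)
    (hβ : ∀ m : ℕ, n ≤ m + 2 * q → m ≤ n → Real.exp (-(c₀ * dq m)) ≤ β) (hβ0 : 0 ≤ β)
    (A : Finset (OddSet n)) (hA : ∀ U ∈ A, U.1.card = 2 * c' + 1) (Y : Finset (PMatch n))
    (hAY : ∀ U ∈ A, ∀ M ∈ Y, cc U M ≠ 1)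
    (Dk : SpreadApproximation (perfectMatchings (univ : Finset (Fin n))) (Y.image Subtype.val) τ q) (i : Fin Dk.k) :
    |∑ U ∈ A, ∑ M ∈ Y.filter (fun M => M.1 ∈ Dk.piece i), levelWeight n (2 * c' + 1) C w U M| ≤
      (4 : ℝ) ^ q * (Bv * Real.sqrt (∏ j ∈ range ((Dg - 4) / 2 + 1), ((2 * j + 1 : ℝ) / ((n : ℝ) - 2 * j)))) +
        β * Bv * (((supersets (perfectMatchings (univ : Finset (Fin n))) (Dk.core i)).card : ℝ) / Fintype.card (PMatch n)) := by
  classical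
  have hS : IsPMOn (verts (Dk.core i)) (Dk.core i) := isPMOn_verts_core (image_val_subset Y) Dk i
  have hBiS : ∀ M ∈ Y.filter (fun M => M.1 ∈ Dk.piece i), Dk.core i ⊆ M.1 :=
    fun M hM => Dk.core_subset_of_mem_piece (mem_filter.1 hM).2
  have hVcard : (verts (Dk.core i)).card = 2 * (Dk.core i).card := hS.two_mul_card.symm
  have hSq : (Dk.core i).card ≤ q := Dk.card_core_le i
  have hVn : (verts (Dk.core i)).card ≤ n := by simpa using card_le_univ (verts (Dk.core i))
  have hm : (univ \ verts (Dk.core i)).card = n - (verts (Dk.core i)).card := by rw [card_univ_sdiff, Fintype.card_fin]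
  have hBv : 0 ≤ Bv := (sum_nonneg fun c _ => abs_nonneg (w c)).trans hdes.2.2.2.2.2.2
  have ht2 : 2 * (2 * c' + 1) + 2 ≤ n := hdes.2.1
  have hPM : (0 : ℝ) < Fintype.card (PMatch n) := by exact_mod_cast card_pmatch_pos hn
  have hCn : (0 : ℝ) < (n.choose (2 * c' + 1) : ℝ) := by exact_mod_cast Nat.choose_pos (by omega)
  set P : ℝ := ∏ j ∈ range ((Dg - 4) / 2 + 1), ((2 * j + 1 : ℝ) / ((n : ℝ) - 2 * j)) with hPdef
  have hP0 : 0 ≤ P :=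
    prod_nonneg fun j hj => (Summit.PneNP.PneNP.Theorems.ChebyshevTracialDesignLevelTail.atten_factor_le_one
      (by have := mem_range.1 hj; omega)).1
  -- split by patterns
  rw [sum_eq_sum_patterns A (verts (Dk.core i))]
  refine (abs_sum_le_sum_abs _ _).trans ?_
  rw [← sum_filter_add_sum_filter_not (verts (Dk.core i)).powerset (fun π => crossCount π (Dk.core i) = 0)]
  -- NON-CROSSING patterns
  have hnc : ∑ π ∈ (verts (Dk.core i)).powerset.filter (fun π => crossCount π (Dk.core i) = 0),
      |∑ U ∈ A.filter (fun U => U.1 ∩ verts (Dk.core i) = π), ∑ M ∈ Y.filter (fun M => M.1 ∈ Dk.piece i),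
        levelWeight n (2 * c' + 1) C w U M| ≤
      β * Bv * (((supersets (perfectMatchings (univ : Finset (Fin n))) (Dk.core i)).card : ℝ) / Fintype.card (PMatch n)) := by
    have hcell : ∀ π ∈ (verts (Dk.core i)).powerset.filter (fun π => crossCount π (Dk.core i) = 0),
        |∑ U ∈ A.filter (fun U => U.1 ∩ verts (Dk.core i) = π), ∑ M ∈ Y.filter (fun M => M.1 ∈ Dk.piece i),
          levelWeight n (2 * c' + 1) C w U M| ≤
        β * ∑ c ∈ C, |w c| * (((Qset (n - (verts (Dk.core i)).card) (2 * c' + 1 - π.card) c).card : ℝ) /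
          (Qset n (2 * c' + 1) c).card) := by
      intro π hπ
      obtain ⟨hπV, hπ0⟩ := mem_filter.1 hπ
      have hπV' : π ⊆ verts (Dk.core i) := mem_powerset.1 hπV
      have hπcard : π.card ≤ 2 * q := (card_le_card hπV').trans (by omega)
      have hp : π.card ≤ 2 * c' + 1 := by omega
      have hπe : Even π.card := by
        have := even_card_inter_of_crossCount_eq_zero hS hπ0
        rwa [inter_eq_left.2 hπV'] at this
      refine abs_noncrossing_cell_le C w hS hπ0 hπV' hp hm A _ hBiS fun c _ => ?_
      -- the SNT dichotomy in `K_m`, `m = n − |V|`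
      have hmq : n ≤ (n - (verts (Dk.core i)).card) + 2 * q := by omega
      have hmn : n - (verts (Dk.core i)).card ≤ n := Nat.sub_le _ _
      have hβm := hβ _ hmq hmn
      have hodd : Odd (2 * c' + 1 - π.card) := by
        obtain ⟨r, hr⟩ := hπe
        exact ⟨c' - r, by omega⟩
      have hevm : Even (n - (verts (Dk.core i)).card) := by
        obtain ⟨r, hr⟩ := hn
        exact ⟨r - (Dk.core i).card, by omega⟩
      obtain ⟨hhom, hcardY⟩ := isRelHomogeneous_pmCellMatchings_piece Y Dk i hm
      refine reduced_mu_le_of_snt hodd _ (fun U hU => card_of_mem_oddCellCuts hA hU) _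
        (tightFree_reduced (fun U hU M hM => hAY U hU M (mem_filter.1 hM).1) hS hπ0 hm) hβm ?_ c
      intro hdX hdY
      exact hSNT _ _ (by omega) hevm hodd (by omega) (by omega) _ (fun U hU => card_of_mem_oddCellCuts hA hU) _ hhom hdX hdY
    refine (sum_le_sum hcell).trans ?_
    rw [← mul_sum]
    have hBvsum : ∑ c ∈ C, |w c| ≤ Bv := hdes.2.2.2.2.2.2
    -- swap the sums and use the pattern-sum bound
    have hswap : ∑ π ∈ (verts (Dk.core i)).powerset.filter (fun π => crossCount π (Dk.core i) = 0),
        ∑ c ∈ C, |w c| * (((Qset (n - (verts (Dk.core i)).card) (2 * c' + 1 - π.card) c).card : ℝ) / (Qset n (2 * c' + 1) c).card) ≤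
        Bv * (((supersets (perfectMatchings (univ : Finset (Fin n))) (Dk.core i)).card : ℝ) / Fintype.card (PMatch n)) := by
      rw [sum_comm]
      have hc : ∀ c ∈ C, ∑ π ∈ (verts (Dk.core i)).powerset.filter (fun π => crossCount π (Dk.core i) = 0),
          |w c| * (((Qset (n - (verts (Dk.core i)).card) (2 * c' + 1 - π.card) c).card : ℝ) / (Qset n (2 * c' + 1) c).card) ≤
          |w c| * (((supersets (perfectMatchings (univ : Finset (Fin n))) (Dk.core i)).card : ℝ) / Fintype.card (PMatch n)) := by
        intro c _
        rw [← mul_sum]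
        refine mul_le_mul_of_nonneg_left ?_ (abs_nonneg _)
        have hsub : (verts (Dk.core i)).powerset.filter (fun π => crossCount π (Dk.core i) = 0) ⊆
            (verts (Dk.core i)).powerset.filter (fun π => crossCount π (Dk.core i) = 0 ∧ π.card ≤ 2 * c' + 1) := by
          intro π hπ
          obtain ⟨hπV, hπ0⟩ := mem_filter.1 hπ
          have : π.card ≤ 2 * q := (card_le_card (mem_powerset.1 hπV)).trans (by omega)
          exact mem_filter.2 ⟨hπV, hπ0, by omega⟩
        refine (sum_le_sum_of_subset_of_nonneg hsub fun _ _ _ => by positivity).trans ?_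
        rw [← card_star_pmatch_eq]
        exact sum_patterns_cellRatio_le ⟨c', rfl⟩ c hS hm
      refine (sum_le_sum hc).trans ?_
      rw [← sum_mul]
      exact mul_le_mul_of_nonneg_right hBvsum (by positivity)
    calc β * ∑ π ∈ (verts (Dk.core i)).powerset.filter (fun π => crossCount π (Dk.core i) = 0),
          ∑ c ∈ C, |w c| * (((Qset (n - (verts (Dk.core i)).card) (2 * c' + 1 - π.card) c).card : ℝ) / (Qset n (2 * c' + 1) c).card)
        ≤ β * (Bv * (((supersets (perfectMatchings (univ : Finset (Fin n))) (Dk.core i)).card : ℝ) / Fintype.card (PMatch n))) :=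
          mul_le_mul_of_nonneg_left hswap hβ0
      _ = _ := by ring
  -- CROSSING patterns
  have hcr : ∑ π ∈ (verts (Dk.core i)).powerset.filter (fun π => ¬crossCount π (Dk.core i) = 0),
      |∑ U ∈ A.filter (fun U => U.1 ∩ verts (Dk.core i) = π), ∑ M ∈ Y.filter (fun M => M.1 ∈ Dk.piece i),
        levelWeight n (2 * c' + 1) C w U M| ≤ (4 : ℝ) ^ q * (Bv * Real.sqrt P) := by
    have hcell : ∀ π ∈ (verts (Dk.core i)).powerset.filter (fun π => ¬crossCount π (Dk.core i) = 0),
        |∑ U ∈ A.filter (fun U => U.1 ∩ verts (Dk.core i) = π), ∑ M ∈ Y.filter (fun M => M.1 ∈ Dk.piece i),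
          levelWeight n (2 * c' + 1) C w U M| ≤ Bv * Real.sqrt P := by
      intro π hπ
      obtain ⟨-, hπ0⟩ := mem_filter.1 hπ
      obtain ⟨e, he⟩ : ((Dk.core i).filter (Crosses π)).Nonempty := by
        rw [nonempty_iff_ne_empty]; intro h0; exact hπ0 (by rw [crossCount, h0, card_empty])
      obtain ⟨heS, hecr⟩ := mem_filter.1 he
      have key : ∀ e' ∈ Dk.core i, Crosses π e' →
          |∑ U ∈ A.filter (fun U => U.1 ∩ verts (Dk.core i) = π), ∑ M ∈ Y.filter (fun M => M.1 ∈ Dk.piece i),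
            levelWeight n (2 * c' + 1) C w U M| ≤
          Bv * Real.sqrt (P * ((((A.filter fun U => U.1 ∩ verts (Dk.core i) = π).card : ℝ) / (n.choose (2 * c' + 1) : ℝ)) *
            (((Y.filter fun M => M.1 ∈ Dk.piece i).card : ℝ) / (Fintype.card (PMatch n) : ℝ)))) := by
        intro e'
        induction e' using Sym2.ind with
        | h a b =>
          intro he' hcr'
          have hab : a ∈ verts (Dk.core i) ∧ b ∈ verts (Dk.core i) := Finset.mk_mem_sym2_iff.1 (hS.1 he')
          have h := abs_crossing_cell_le hn hdes hDg hDg4 hab.1 hab.2 hcr' A hA (Y.filter fun M => M.1 ∈ Dk.piece i)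
            (fun M hM => hBiS M hM he')
          rwa [mul_assoc] at h
      refine (key e heS hecr).trans (mul_le_mul_of_nonneg_left (Real.sqrt_le_sqrt ?_) hBv)
      -- `P · μ · ν ≤ P`
      have hμ1 : (((A.filter fun U => U.1 ∩ verts (Dk.core i) = π).card : ℝ) / (n.choose (2 * c' + 1) : ℝ)) ≤ 1 := by
        rw [div_le_one hCn, ← card_tcuts_eq_choose (n := n) ⟨c', rfl⟩]
        exact_mod_cast card_le_card fun U hU => by
          rw [mem_filter] at hU ⊢; exact ⟨mem_univ _, hA U hU.1⟩
      have hν1 : (((Y.filter fun M => M.1 ∈ Dk.piece i).card : ℝ) / (Fintype.card (PMatch n) : ℝ)) ≤ 1 := by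
        rw [div_le_one hPM]
        exact_mod_cast (card_le_univ _).trans_eq Finset.card_univ
      calc P * (((((A.filter fun U => U.1 ∩ verts (Dk.core i) = π).card : ℝ) / (n.choose (2 * c' + 1) : ℝ)) *
            (((Y.filter fun M => M.1 ∈ Dk.piece i).card : ℝ) / (Fintype.card (PMatch n) : ℝ))))
          ≤ P * (1 * 1) := by
            refine mul_le_mul_of_nonneg_left (mul_le_mul hμ1 hν1 (by positivity) zero_le_one) hP0
        _ = P := by ring
    refine (sum_le_sum hcell).trans ?_
    rw [sum_const, nsmul_eq_mul]
    refine mul_le_mul_of_nonneg_right ?_ (by positivity)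
    calc (((verts (Dk.core i)).powerset.filter (fun π => ¬crossCount π (Dk.core i) = 0)).card : ℝ)
        ≤ ((verts (Dk.core i)).powerset.card : ℝ) := by exact_mod_cast card_filter_le _ _
      _ = (2 : ℝ) ^ (2 * (Dk.core i).card) := by rw [card_powerset, hVcard]; push_cast; ring
      _ = (4 : ℝ) ^ (Dk.core i).card := by rw [pow_mul]; norm_num
      _ ≤ (4 : ℝ) ^ q := pow_le_pow_right₀ (by norm_num) hSq
  linarith [hnc, hcr]

end Summit.PneNP.PneNP.Theorems.ChebyshevTracialDesignRungPieces
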